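import Summits.CriticalPhenomena.CardyFormulaZ2.Theorems.CardyIKTransportIKMixedBoxCrossingTransportStubLinkIsoTraceAux
import Summits.CriticalPhenomena.CardyFormulaZ2.Theorems.CardyIKTransportIKMixedBoxCrossingTransportStubLinkArcsIffAux

/-!
# Stub `stub_linkIsoTraceNorm` (line `defect-closure-exploration`, reshape v5b, crux `IKMixedBoxCrossing`,
# stmt-CriticalPhenomena-5911): H3 · THE ISOTROPIC TRACE FORMULA, and the normalisations

Support file (`--supports stmt-CriticalPhenomena-5911`): `stub_linkIsoTraceNorm : LinkIsoTrace ∧ LinkNorm` (vocabulary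
`…TransportLinkDefs.lean`, p135510; transfer matrices and the kernel of one block: `…TransportStubLinkIsoTraceAux.lean`, p136746;
necklace layout lemmas reused from the sibling stubs `…StubLinkHonCount.lean`, `…StubLinkArcsIffAux.lean`;
paper proof: lead c5 memo `Lines/defect-closure-exploration-c5.md` §9.2).

* §5 Necklace bookkeeping: block `i` occupies the offsets `[runStart i, runStart i + len i)`, the blocks are ordered, disjoint and
  tile `[0, L)`; the ROW CHART `π : (Σ i, Fin (len i)) ≃ ZMod L` and the CONFIGURATION EQUIVALENCE
  `cfgE : (chain colours η, flags f) ≃ block-local states` (`LocSt` of the helper file); the presented column is white on the gaps.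
* §6 Gluing: after the involution `c ↦ ξ ⊕ c` (`ξ = N.col`) the isotropic weight of the last face column is the product of the
  block weights `wtloc` (`weight_eq`; the exit colour of block `i` is the head colour of the cyclically next block, `row_next`), and
  the crossing of gap `i` is the local indicator `crossLoc` of block `i` (`cross_eq`).
* §7 THE HYBRID TRACE FORMULA `sum_hybrid`: for every set `T` of free gaps and crossing pattern `x`, the isotropic weight of the new
  columns whose crossings agree with `x` outside `T` is `W T x` (the cycle lemma `cycSum_eq_trace` + the block kernel `locMat_eq` of
  the helper file).  `T = ∅` is H3 `LinkIsoTrace`; `T = univ` with `CylBunchStub.colSum_eq_colConst` gives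
  `colConst true L = W univ`, hence its positivity (`CylBunchStub.colConst_pos`); `colConst false L = 2^L` by counting (only the flags
  `≡ true` carry weight through a honeycomb face column).
-/

noncomputable section

namespace Summit.CriticalPhenomena.CardyFormulaZ2.Cruxes.IKMixedBoxCrossing.DefectClosureExploration

open scoped BigOperators Classical
open Finset Matrix
open Summit.CriticalPhenomena.CardyFormulaZ2.Theorems.IKLinearTransport.PinnedDiagramExchange (faceWeight)
open CylBunchStub (colConst)
open LinkHonCountStub (blockEnd_le_runStart blockEnd_le row_inj)
open LinkArcsIffStub (row_gapEnd row_succ col_row_of_inRun not_inRun_inGap inGap_lt exists_inRun_of_col)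

namespace LinkIsoTraceStub

/-! ## §5 Necklace arithmetic: block offsets, rows, the configuration equivalence -/

section Neck

variable {L : ℕ} (N : Necklace L)

/-- Length of block `i` (run and gap). -/
def len (i : Fin N.k) : ℕ := N.runLen i + N.gapLen i

/-- Blocks have at least two offsets. -/
theorem len_pos (i : Fin N.k) : 0 < len N i := by
  have := N.run_pos i
  unfold len
  omega

/-- End of block `i`. -/
theorem blockEnd (i : Fin N.k) : N.gapStart i + N.gapLen i = N.runStart i + len N i := by
  unfold Necklace.gapStart len
  omega

/-- Blocks are ordered: block `i` ends before block `j` starts, `i < j`. -/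
theorem runStart_add_len_le (i j : Fin N.k) (h : i < j) : N.runStart i + len N i ≤ N.runStart j := by
  rw [← blockEnd]
  exact blockEnd_le_runStart N h

/-- Every block ends by `L`. -/
theorem runStart_add_len_le_L (i : Fin N.k) : N.runStart i + len N i ≤ L := by
  rw [← blockEnd]
  exact blockEnd_le N i

/-- The end of block `i` is (modulo `L`) the start of the cyclically next block. -/
theorem row_next (i : Fin N.k) : N.row (N.runStart i + len N i) = N.row (N.runStart (nxI N.hk i) + 0) := by
  rw [Nat.add_zero, ← blockEnd]
  exact row_gapEnd N i (nxI N.hk i) rfl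

/-- The presented column is WHITE on the gaps. -/
theorem col_row_gap (i : Fin N.k) (o : ℕ) (ho : N.InGap i o) : N.col (N.row o) = false := by
  by_contra h
  rw [Bool.not_eq_false] at h
  obtain ⟨j, o', ho', hrun, hrow⟩ := exists_inRun_of_col N h
  have hoo := row_inj N ho' (inGap_lt N ho) hrow
  subst hoo
  exact not_inRun_inGap N hrun ho

/-- Offset of a (block, position) pair. -/
def off (q : Σ i : Fin N.k, Fin (len N i)) : ℕ := N.runStart q.1 + q.2.val

/-- Offsets are `< L`. -/
theorem off_lt (q : Σ i : Fin N.k, Fin (len N i)) : off N q < L :=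
  lt_of_lt_of_le (Nat.add_lt_add_left q.2.isLt _) (runStart_add_len_le_L N q.1)

/-- (block, position) ↦ offset is injective (the blocks are disjoint). -/
theorem off_inj : Function.Injective (off N) := by
  rintro ⟨i, p⟩ ⟨j, q⟩ h
  simp only [off] at h
  have hij : i = j := by
    by_contra hne
    rcases lt_or_gt_of_ne hne with hlt | hlt
    · have := runStart_add_len_le N i j hlt
      have := p.isLt
      omega
    · have := runStart_add_len_le N j i hlt
      have := q.isLt
      omega
  subst hij
  have hpq : p = q := Fin.ext (by omega)
  subst hpq
  rfl

variable [NeZero L]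

/-- THE ROW CHART: (block, position) ≃ rows of the cylinder. -/
def π : (Σ i : Fin N.k, Fin (len N i)) ≃ ZMod L :=
  Equiv.ofBijective (fun q => N.row (off N q)) (by
    rw [Fintype.bijective_iff_injective_and_card]
    refine ⟨fun q q' h => off_inj N (row_inj N (off_lt N q) (off_lt N q') h), ?_⟩
    simp only [Fintype.card_sigma, Fintype.card_fin, ZMod.card]
    exact N.total)

/-- `false ↦ 0`, `true ↦ 1`. -/
def b2 : Bool ≃ Fin 2 := finTwoEquiv.symm

/-- `b2 b = 1 ↔ b`. -/
theorem b2_eq_one (b : Bool) : b2 b = 1 ↔ b = true := by cases b <;> decide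

/-- `b2 b = 0 ↔ ¬ b`. -/
theorem b2_eq_zero (b : Bool) : b2 b = 0 ↔ b = false := by cases b <;> decide

/-- The isotropic face weight in the chain variables is `S / 2`. -/
theorem faceWeight_true_eq (a a' φ : Bool) : faceWeight true (a ^^ a') φ = Smat (b2 a) (b2 a') / 2 := by
  unfold faceWeight Smat tI
  cases a <;> cases a' <;> simp [b2, finTwoEquiv]

/-- THE CONFIGURATION EQUIVALENCE: (chain colours, flags) on the cylinder ≃ block-local states. -/
def cfgE : ((ZMod L → Bool) × (ZMod L → Bool)) ≃ (∀ i : Fin N.k, LocSt (len N i)) :=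
  ((Equiv.arrowProdEquivProdArrow (ZMod L) (fun _ => Bool) (fun _ => Bool)).symm.trans
    (Equiv.arrowCongr (π N).symm (Equiv.prodCongr b2 (Equiv.refl Bool)))).trans
    (Equiv.piCurry fun (i : Fin N.k) (_ : Fin (len N i)) => Fin 2 × Bool)

/-- Its value. -/
theorem cfgE_apply (p : (ZMod L → Bool) × (ZMod L → Bool)) (i : Fin N.k) (q : Fin (len N i)) :
    cfgE N p i q = (b2 (p.1 (N.row (N.runStart i + q.val))), p.2 (N.row (N.runStart i + q.val))) := rfl

/-- Head colour of a block-local state. -/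
def hd (i : Fin N.k) (s : LocSt (len N i)) : Fin 2 := (s ⟨0, len_pos N i⟩).1

/-! ## §6 Gluing: the weight and the crossings in block-local coordinates -/

/-- The isotropic weight of the last face column factorises over the blocks. -/
theorem weight_eq (η f : ZMod L → Bool) :
    lastColWeight true L N.col (fun r => N.col r ^^ η r) f =
      ∏ i, wtloc (cfgE N (η, f) i) (hd N (nxI N.hk i) (cfgE N (η, f) (nxI N.hk i))) := by
  unfold lastColWeight
  have h1 : ∀ r, ((N.col r ^^ (N.col r ^^ η r)) ^^ (N.col (r + 1) ^^ (N.col (r + 1) ^^ η (r + 1)))) =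
      (η r ^^ η (r + 1)) := fun r => by
    cases N.col r <;> cases N.col (r + 1) <;> simp
  simp only [h1, faceWeight_true_eq]
  rw [← (π N).prod_comp, Fintype.prod_sigma]
  refine Finset.prod_congr rfl fun i _ => ?_
  unfold wtloc
  refine Finset.prod_congr rfl fun q _ => ?_
  have e1 : (π N) ⟨i, q⟩ = N.row (N.runStart i + q.val) := rfl
  rw [e1, cfgE_apply]
  congr 2
  unfold nxc
  split_ifs with h
  · rw [cfgE_apply]
    dsimp only
    rw [← row_succ, add_assoc]
  · have hq : q.val + 1 = len N i := by have := q.isLt; omega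
    unfold hd
    rw [cfgE_apply]
    dsimp only
    rw [← row_next, ← row_succ, add_assoc, hq]

/-- The crossing of gap `i` in block-local coordinates. -/
theorem cross_eq (η f : ZMod L → Bool) (i : Fin N.k) :
    N.cross (fun r => N.col r ^^ η r) f i =
      crossLoc (N.runLen i) (len N i) (cfgE N (η, f) i) (hd N (nxI N.hk i) (cfgE N (η, f) (nxI N.hk i))) := by
  have hr := N.run_pos i
  have hbot : N.gapStart i - 1 = N.runStart i + (N.runLen i - 1) := by unfold Necklace.gapStart; omega
  have htop : N.gapStart i + N.gapLen i = N.runStart i + len N i := by unfold Necklace.gapStart len; omega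
  have htop' : N.gapStart i + N.gapLen i - 1 = N.runStart i + (len N i - 1) := by
    have := N.gap_pos i
    unfold Necklace.gapStart len
    omega
  have cbot : N.col (N.row (N.runStart i + (N.runLen i - 1))) = true :=
    col_row_of_inRun N (i := i) ⟨by omega, by unfold Necklace.gapStart; omega⟩
  have ctop : N.col (N.row (N.gapStart i + N.gapLen i)) = true := by
    rw [htop, row_next]
    have h1 := N.run_pos (nxI N.hk i)
    exact col_row_of_inRun N (i := nxI N.hk i) ⟨by omega, by unfold Necklace.gapStart; omega⟩
  have hhd : hd N (nxI N.hk i) (cfgE N (η, f) (nxI N.hk i)) = b2 (η (N.row (N.gapStart i + N.gapLen i))) := by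
    unfold hd
    rw [cfgE_apply, htop, row_next]
  unfold Necklace.cross crossLoc
  rw [decide_eq_decide, hbot, htop', hhd]
  simp only [cfgE_apply]
  refine and_congr ?_ (and_congr ?_ ?_)
  · constructor
    · intro h p hp
      rw [b2_eq_one]
      have hgap : N.InGap i (N.runStart i + p.val) :=
        ⟨by unfold Necklace.gapStart; omega, by have := p.isLt; unfold Necklace.gapStart; unfold len at this; omega⟩
      have h' := h _ hgap
      rw [col_row_gap N i _ hgap] at h'
      simpa using h'
    · intro h o ho
      obtain ⟨ho1, ho2⟩ := id ho
      unfold Necklace.gapStart at ho1 ho2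
      have h' := h ⟨o - N.runStart i, by unfold len; omega⟩ (by dsimp only; omega)
      rw [b2_eq_one] at h'
      dsimp only at h'
      rw [show N.runStart i + (o - N.runStart i) = o by omega] at h'
      rw [col_row_gap N i o ho, h']
      rfl
  · rw [cbot]
    constructor
    · intro h p hp
      rw [hp, b2_eq_zero]
      rcases h with h | h
      · left; simpa using h
      · right; exact h
    · intro h
      have h' := h ⟨N.runLen i - 1, by unfold len; omega⟩ rfl
      rw [b2_eq_zero] at h'
      dsimp only at h'
      rcases h' with h' | h'
      · left; rw [h']; rfl
      · right; exact h'
  · rw [ctop, b2_eq_zero]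
    have hl := len_pos N i
    constructor
    · intro h p hp
      rw [hp]
      rcases h with h | h
      · left; simpa using h
      · right; exact h
    · intro h
      have h' := h ⟨len N i - 1, by omega⟩ rfl
      dsimp only at h'
      rcases h' with h' | h'
      · left; rw [h']; rfl
      · right; exact h'

/-! ## §7 The hybrid trace formula, H3 and the normalisations -/

/-- THE HYBRID TRACE FORMULA: the isotropic weight of the new columns whose crossings agree with `x` outside `T`
is `W T x`. -/
theorem sum_hybrid (T : Finset (Fin N.k)) (x : Fin N.k → Bool) :
    (∑ p : (ZMod L → Bool) × (ZMod L → Bool),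
      if ∀ i, i ∈ T ∨ N.cross p.1 p.2 i = x i then lastColWeight true L N.col p.1 p.2 else 0) = N.W T x := by
  have hinv : Function.Involutive (fun c : ZMod L → Bool => fun r => N.col r ^^ c r) := fun c =>
    funext fun r => by cases N.col r <;> simp
  rw [← (Equiv.prodCongr (hinv.toPerm _) (Equiv.refl (ZMod L → Bool))).sum_comp]
  rw [Fintype.sum_equiv (cfgE N) _ (fun σ => ∏ i, locK (N.runLen i) (len N i) (decide (i ∈ T)) (x i) (σ i)
      (hd N (nxI N.hk i) (σ (nxI N.hk i)))) ?_]
  · rw [cycSum_eq_trace N.hk (hd N)]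
    unfold Necklace.W Necklace.prodMat
    have hfun : (fun i => Matrix.of fun e e' => ∑ s, if hd N i s = e then
        locK (N.runLen i) (len N i) (decide (i ∈ T)) (x i) s e' else 0) = fun i => N.block T x i := by
      funext i
      change locMat (N.runLen i) (N.runLen i + N.gapLen i) (len_pos N i) (decide (i ∈ T)) (x i) = N.block T x i
      rw [locMat_eq _ _ (N.run_pos i) (N.gap_pos i)]
      unfold Necklace.block
      by_cases hT : i ∈ T <;> simp [hT]
    rw [hfun]
  · rintro ⟨η, f⟩
    simp only [Equiv.prodCongr_apply, Prod.map, Function.Involutive.coe_toPerm, Equiv.coe_refl, id]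
    unfold locK
    rw [Fintype.prod_ite_zero, weight_eq]
    refine @if_congr _ _ _ (_) (_) _ _ _ _ (forall_congr' fun i => ?_) rfl rfl
    rw [decide_eq_true_eq, cross_eq]

/-- **H3 · the isotropic trace formula.** -/
theorem linkIsoTrace : LinkIsoTrace := by
  intro L _ N x
  rw [← sum_hybrid N ∅ x]
  refine Finset.sum_congr rfl fun p _ => ?_
  have h : (N.crossVec p.1 p.2 = x) ↔ ∀ i, i ∈ (∅ : Finset (Fin N.k)) ∨ N.cross p.1 p.2 i = x i := by
    simp only [Finset.notMem_empty, false_or]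
    exact funext_iff
  simp only [h]

/-- **The normalisations**: `colConst false L = 2^L`, `colConst true L = W univ = tr(S^L) > 0`. -/
theorem linkNorm : LinkNorm := by
  intro L _ N
  have hT : colConst true L = N.W Finset.univ (fun _ => true) := by
    rw [← CylBunchStub.colSum_eq_colConst true L N.col, ← sum_hybrid N Finset.univ (fun _ => true),
      Fintype.sum_prod_type]
    refine Finset.sum_congr rfl fun η _ => Finset.sum_congr rfl fun φ _ => ?_
    rw [if_pos (fun i => Or.inl (Finset.mem_univ i))]
    rfl
  refine ⟨?_, hT, hT ▸ CylBunchStub.colConst_pos true L⟩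
  unfold CylBunchStub.colConst
  have hw : ∀ δ φ : ZMod L → Bool, (∏ r : ZMod L, faceWeight false (δ r ^^ δ (r + 1)) (φ r)) =
      if φ = fun _ => true then 1 else 0 := by
    intro δ φ
    have h1 : ∀ r, faceWeight false (δ r ^^ δ (r + 1)) (φ r) = if φ r = true then 1 else 0 := fun r => by
      unfold faceWeight
      simp
    simp only [h1, Fintype.prod_boole]
    congr 1
    rw [funext_iff]
  simp only [hw, Finset.sum_ite_eq', Finset.mem_univ, if_true, Finset.sum_const, Finset.card_univ,
    Fintype.card_fun, ZMod.card, Fintype.card_bool, nsmul_eq_mul, mul_one]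
  push_cast
  ring

end Neck

end LinkIsoTraceStub

/-- **STUB v5b-4 · `stub_linkIsoTraceNorm`**: H3 (the isotropic trace formula) and the normalisations. -/
theorem stub_linkIsoTraceNorm : LinkIsoTrace ∧ LinkNorm :=
  ⟨LinkIsoTraceStub.linkIsoTrace, LinkIsoTraceStub.linkNorm⟩

end Summit.CriticalPhenomena.CardyFormulaZ2.Cruxes.IKMixedBoxCrossing.DefectClosureExploration

end
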